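import Summits.ResolutionOfSingularities.ResolutionOfSingularities.Theorems.WeightedInvariantContactCylinderValue
import Summits.ResolutionOfSingularities.ResolutionOfSingularities.Theorems.WeightedInvariantContactCentreFiltrationEssSmooth
import Literature.AlgebraicGeometry.Resolution.CotangentFlatAscent
import Mathlib.RingTheory.Flat.FaithfullyFlat.Algebra
import HarnessLib

/-!
# The cylinder rule is compatible with essentially smooth local homomorphisms in regime P3a — the def-free kernel of
# (D2) «(c11) for the cylinder `J`» of ORDER (o28)
# (door `HypersurfaceCentreConstruction`, stmt-ResolutionOfSingularities-19897; KEY `stub_localWeightedDropEFT4S` beyond the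
# P2 rung, regime P3a «the top stratum through the closed point is a regular germ of codimension two»)

Topic: `Summits/ResolutionOfSingularities/ResolutionOfSingularities/Theorems`. Helper for the door item
`HypersurfaceCentreConstruction` (stmt-ResolutionOfSingularities-19897, route `WeightedInvariant`), line `local-engine` of
res-L1-w43-plan-1 (L W4.3), ORDER (o28) (lead res-type-005, co-hand res-D-brk-1; 005 MEMO v2 2026-08-27T10:22:57Z §5 (D2)).

THE CYLINDER RULE at a regular local position `S` whose top stratum is the regular germ `V(𝔭)`, `𝔭 = (x, g)` with
independent differentials: `J(S, f, m) := (jContact (S_𝔭) f m) ∩ S` (`= (x, g; 1, b_max)_m`, res-D-brk-1 p522408).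
THIS FILE: for an essentially smooth local homomorphism `φ : S → S'` of regular local rings (local, formally smooth,
essentially of finite type; `S` of ANY dimension) the pair `(φ x, φ g)` again has independent differentials
(Literature `CotangentFlatAscent`, Matsumura 23.7, through res-type-070's flatness and regular closed fibre), `𝔭' := (φ x, φ g)`
is prime, `𝔭' ∩ S = 𝔭` (faithful flatness), and the CYLINDER VALUES ARE COMPATIBLE:
`(jContact (S'_{𝔭'}) f m) ∩ S' = ((jContact (S_𝔭) f m) ∩ S) · S'` — both sides equal `(φ x, φ g; 1, b_max)_m` with `b_max`
READ AT `S_𝔭`: the right side by the VALUE (P3a-1); the left side by res-type-078's P2 clause (c11)↾≤2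
(`EssSmoothCentre.iotaJEssSmoothCompatibleLE2_iotaOrd_jContact`, p520664) applied to the LOCALISED homomorphism
`S_𝔭 → S'_{𝔭'}` (`Localization.localRingHom`; formally smooth by Mathlib `FormallySmooth.localization_base`, essentially of
finite type by `EssFiniteType.of_comp`, `dim S'_{𝔭'} = ht 𝔭' ≤ 2` by Krull's height theorem), `weightedMonomialIdeal_map`,
and res-type-005's contraction brick (p521270) in `S'`.  This is the (c11) clause `IotaJEssSmoothCompatible`'s J-part for
the cylinder in regime P3a, stated at the given stratum prime (the named `jCylinder` wrapper of 005's (D1) is a corollary).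

## Contents (sorry-free, standard axioms; NO definitions)

* `linearIndependent_toCotangent_pair_map` — `(φ x, φ g)` has independent differentials in `S'`.
* `isPrime_span_pair_map` — `(φ x, φ g)` is a prime of `S'`; `comap_span_pair_map` — `(φ x, φ g) ∩ S = (x, g)`.
* `ringKrullDim_atPrime_span_pair_le_two` — `dim S'_{(a, b)} ≤ 2` for any prime `(a, b)` of a Noetherian ring.
* **`cylinder_map_compatible`** — the compatibility above, for every `m`.

[OURS · L1 W4.3 · (o28) P3a probe]  Replaces the role of NO printed item; NOT a statement of the manuscript
[claim: Hironaka2017, status: under-review]. AI work, weaker than expert review.  Pure commutative algebra; no named facts.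

## References

* H. Matsumura, *Commutative Ring Theory* (1987), Thm. 4.3, 7.5 (faithful flatness), 13.5 (Krull), 19.3, 23.7. [Matsumura1987]
* res-type-005, `plan/tools/res-type-005/o28/P3A-PROBE.md` v2 §5 (OURS, AI design input).
-/

noncomputable section

open IsLocalRing Literature.AlgebraicGeometry.Resolution
open Summit.ResolutionOfSingularities.ResolutionOfSingularities.Cruxes.HypersurfaceCentreConstruction.LocalEngine

set_option linter.dupNamespace false -- mandated namespace of this single-conjunct summit

namespace Summit.ResolutionOfSingularities.ResolutionOfSingularities.Theorems

namespace ContactCylinder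

/-! ## The pair `(φ x, φ g)` in `S'` -/

section Pair

variable (S S' : Type) [CommRing S] [IsRegularLocalRing S] [CommRing S'] [IsRegularLocalRing S'] [Algebra S S']
  [IsLocalHom (algebraMap S S')] [Algebra.FormallySmooth S S'] [Algebra.EssFiniteType S S'] (x g : S)
  (hxg : ∀ i, (![x, g] : Fin 2 → S) i ∈ maximalIdeal S)
  (hli : LinearIndependent (ResidueField S) (fun i => (maximalIdeal S).toCotangent ⟨(![x, g] : Fin 2 → S) i, hxg i⟩))

omit [Algebra.FormallySmooth S S'] [Algebra.EssFiniteType S S'] in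
include hxg in
/-- The images `φ x, φ g` lie in `𝔪_{S'}` (local homomorphism). [folklore] -/
theorem pair_map_mem_maximalIdeal :
    ∀ i, (![algebraMap S S' x, algebraMap S S' g] : Fin 2 → S') i ∈ maximalIdeal S' := by
  intro i; fin_cases i
  · exact map_nonunit (algebraMap S S') x (hxg 0)
  · exact map_nonunit (algebraMap S S') g (hxg 1)

include hli in
/-- **Independent differentials ascend along an essentially smooth local homomorphism**: `(φ x, φ g)` has independent
classes in `𝔪_{S'}/𝔪_{S'}²` (Literature `CotangentFlatAscent`, Matsumura 23.7: `S'` is flat over `S` —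
res-type-070's `flat_of_formallySmooth_of_essFiniteType` — with regular closed fibre `S'/𝔪_S S'` —
`isRegularLocalRing_fiber`). [cite: Matsumura1987, Thm. 23.7] -/
theorem linearIndependent_toCotangent_pair_map :
    LinearIndependent (ResidueField S') (fun i => (maximalIdeal S').toCotangent
      ⟨(![algebraMap S S' x, algebraMap S S' g] : Fin 2 → S') i, pair_map_mem_maximalIdeal S S' x g hxg i⟩) := by
  haveI : Module.Flat S S' := flat_of_formallySmooth_of_essFiniteType S S'
  haveI : IsRegularLocalRing (S' ⧸ (maximalIdeal S).map (algebraMap S S')) := isRegularLocalRing_fiber S S'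
  have h := linearIndependent_toCotangent_map_of_flat_of_isRegularLocalRing_fibre (S := S') (![x, g]) hxg hli
  have hfun : (fun i => (maximalIdeal S').toCotangent ⟨algebraMap S S' ((![x, g] : Fin 2 → S) i),
        map_nonunit (algebraMap S S') _ (hxg i)⟩) =
      (fun i => (maximalIdeal S').toCotangent
        ⟨(![algebraMap S S' x, algebraMap S S' g] : Fin 2 → S') i, pair_map_mem_maximalIdeal S S' x g hxg i⟩) := by
    funext i; fin_cases i <;> rfl
  rw [hfun] at h
  exact h

include hli in
/-- `(φ x, φ g)` is a prime ideal of `S'` (part of a regular system of parameters, Matsumura 14.2).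
[cite: Matsumura1987, Thm. 14.2] -/
theorem isPrime_span_pair_map : (Ideal.span {algebraMap S S' x, algebraMap S S' g}).IsPrime := by
  have h := isPrime_span_image_of_linearIndependent_toCotangent (![algebraMap S S' x, algebraMap S S' g])
    (pair_map_mem_maximalIdeal S S' x g hxg) (linearIndependent_toCotangent_pair_map S S' x g hxg hli) Set.univ
  rwa [Set.image_univ, Matrix.range_cons_cons_empty] at h

omit [IsRegularLocalRing S] [IsRegularLocalRing S'] [IsLocalHom (algebraMap S S')] [Algebra.FormallySmooth S S']
  [Algebra.EssFiniteType S S'] in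
/-- `(φ x, φ g) = (x, g) S'`. [folklore] -/
theorem span_pair_map_eq_map :
    Ideal.span {algebraMap S S' x, algebraMap S S' g} = (Ideal.span {x, g}).map (algebraMap S S') := by
  rw [Ideal.map_span, Set.image_pair]

/-- **`(φ x, φ g) ∩ S = (x, g)`** (faithful flatness of the flat local homomorphism `S → S'`).
[cite: Matsumura1987, Thm. 7.5] -/
theorem comap_span_pair_map :
    (Ideal.span {algebraMap S S' x, algebraMap S S' g}).comap (algebraMap S S') = Ideal.span {x, g} := by
  haveI : Module.Flat S S' := flat_of_formallySmooth_of_essFiniteType S S'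
  haveI : Module.FaithfullyFlat S S' := Module.FaithfullyFlat.of_flat_of_isLocalHom
  rw [span_pair_map_eq_map, Ideal.comap_map_eq_self_of_faithfullyFlat]

end Pair

/-- **`dim R_𝔮 ≤ 2` for a prime `𝔮 = (a, b)` generated by two elements of a Noetherian ring** (Krull's height theorem:
`dim R_𝔮 = ht 𝔮 ≤ μ(𝔮) ≤ 2`). [cite: Matsumura1987, Thm. 13.5] -/
theorem ringKrullDim_atPrime_span_pair_le_two {R : Type} [CommRing R] [IsNoetherianRing R] (a b : R)
    [(Ideal.span {a, b}).IsPrime] : ringKrullDim (Localization.AtPrime (Ideal.span {a, b})) ≤ 2 := by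
  rw [IsLocalization.AtPrime.ringKrullDim_eq_height (Ideal.span {a, b}) (Localization.AtPrime (Ideal.span {a, b}))]
  have h1 : (Ideal.span {a, b}).height ≤ (Ideal.span {a, b}).spanFinrank :=
    Ideal.height_le_spanFinrank _ (Ideal.IsPrime.ne_top ‹_›)
  have h2 : (Ideal.span ({a, b} : Set R)).spanFinrank ≤ 2 := by
    refine (Submodule.spanFinrank_span_le_ncard_of_finite (Set.toFinite _)).trans ?_
    exact (Set.ncard_insert_le a {b}).trans (by rw [Set.ncard_singleton])
  have h2' : ((Ideal.span ({a, b} : Set R)).spanFinrank : ℕ∞) ≤ 2 := by exact_mod_cast h2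
  have h3 : (Ideal.span {a, b}).height ≤ 2 := h1.trans h2'
  exact (WithBot.coe_le_coe.mpr h3).trans_eq (WithBot.coe_ofNat 2)

/-! ## Compatibility of the cylinder values along `S → S'` -/

/-- **The cylinder rule is compatible with essentially smooth local homomorphisms (regime P3a).**  `φ : S → S'` an
essentially smooth local homomorphism of regular local rings (`S` of any dimension); `x, g ∈ 𝔪_S` with independent
differentials, `𝔭 = (x, g)` prime; `f ∈ S` with `f/1 ≠ 0` NOT of monomial type in `S_𝔭`, `g/1` carrying `f/1` to the
terminal level `b_max ≥ 1` of `S_𝔭`; `𝔭' = (φ x, φ g)` (prime by `isPrime_span_pair_map`; the instance is a binder so that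
`S'_{𝔭'}` can be named).  Then for every `m`:
`(jContact (S'_{𝔭'}) f m) ∩ S' = ((jContact (S_𝔭) f m) ∩ S) · S'` — the cylinder value at `S'` IS the extension of the
cylinder value at `S`, both equal to `(φ x, φ g; 1, b_max)_m` with `b_max` read at `S_𝔭`. [OURS · L1 W4.3 · (o28) (D2)] -/
theorem cylinder_map_compatible (S S' : Type) [CommRing S] [IsRegularLocalRing S] [CommRing S'] [IsRegularLocalRing S']
    [Algebra S S'] [IsLocalHom (algebraMap S S')] [Algebra.FormallySmooth S S'] [Algebra.EssFiniteType S S']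
    (x g : S) (hxg : ∀ i, (![x, g] : Fin 2 → S) i ∈ maximalIdeal S)
    (hli : LinearIndependent (ResidueField S) (fun i => (maximalIdeal S).toCotangent ⟨(![x, g] : Fin 2 → S) i, hxg i⟩))
    [(Ideal.span {x, g}).IsPrime] (f : S)
    (hf0 : algebraMap S (Localization.AtPrime (Ideal.span {x, g})) f ≠ 0)
    (hnm : ¬ IsMonomialType (algebraMap S (Localization.AtPrime (Ideal.span {x, g})) f))
    (hreach : algebraMap S (Localization.AtPrime (Ideal.span {x, g})) f ∈
      contactFiltration (algebraMap S (Localization.AtPrime (Ideal.span {x, g})) g)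
        (bMax (algebraMap S (Localization.AtPrime (Ideal.span {x, g})) f))
        (bMax (algebraMap S (Localization.AtPrime (Ideal.span {x, g})) f) *
          (adicOrder (algebraMap S (Localization.AtPrime (Ideal.span {x, g})) f)).toNat))
    (hb : 1 ≤ bMax (algebraMap S (Localization.AtPrime (Ideal.span {x, g})) f))
    [(Ideal.span {algebraMap S S' x, algebraMap S S' g}).IsPrime] (m : ℕ) :
    (jContact (Localization.AtPrime (Ideal.span {algebraMap S S' x, algebraMap S S' g}))
        (algebraMap S _ f) m).comap
      (algebraMap S' (Localization.AtPrime (Ideal.span {algebraMap S S' x, algebraMap S S' g}))) =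
    ((jContact (Localization.AtPrime (Ideal.span {x, g}))
        (algebraMap S (Localization.AtPrime (Ideal.span {x, g})) f) m).comap
      (algebraMap S (Localization.AtPrime (Ideal.span {x, g})))).map (algebraMap S S') := by
  -- the two localisations are regular local rings
  haveI : IsRegularLocalRing (Localization.AtPrime (Ideal.span {x, g})) :=
    isRegularLocalRing_localization_atPrime S _
  haveI : IsRegularLocalRing (Localization.AtPrime (Ideal.span {algebraMap S S' x, algebraMap S S' g})) :=
    isRegularLocalRing_localization_atPrime S' _
  have hxg' := pair_map_mem_maximalIdeal S S' x g hxg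
  have hli' := linearIndependent_toCotangent_pair_map S S' x g hxg hli
  have hvec : (fun i => algebraMap S S' ((![x, g] : Fin 2 → S) i)) = ![algebraMap S S' x, algebraMap S S' g] := by
    funext i; fin_cases i <;> rfl
  -- the right side: the VALUE at `S`, extended
  rw [cylinder_comap_eq_weightedMonomialIdeal S x g hxg hli f hf0 hnm hreach hb m, weightedMonomialIdeal_map, hvec]
  -- the localised homomorphism `ψ : S_𝔭 → S'_{𝔭'}`
  have h𝔭𝔭' : Ideal.span {x, g} =
      (Ideal.span {algebraMap S S' x, algebraMap S S' g}).comap (algebraMap S S') :=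
    (comap_span_pair_map S S' x g).symm
  letI : Algebra (Localization.AtPrime (Ideal.span {x, g}))
      (Localization.AtPrime (Ideal.span {algebraMap S S' x, algebraMap S S' g})) :=
    (Localization.localRingHom (Ideal.span {x, g}) (Ideal.span {algebraMap S S' x, algebraMap S S' g})
      (algebraMap S S') h𝔭𝔭').toAlgebra
  haveI : IsScalarTower S (Localization.AtPrime (Ideal.span {x, g}))
      (Localization.AtPrime (Ideal.span {algebraMap S S' x, algebraMap S S' g})) :=
    IsScalarTower.of_algebraMap_eq fun s => by
      change _ = Localization.localRingHom (Ideal.span {x, g}) (Ideal.span {algebraMap S S' x, algebraMap S S' g})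
        (algebraMap S S') h𝔭𝔭' (algebraMap S _ s)
      rw [Localization.localRingHom_to_map,
        IsScalarTower.algebraMap_apply S S' (Localization.AtPrime (Ideal.span {algebraMap S S' x, algebraMap S S' g}))]
  haveI : IsLocalHom (algebraMap (Localization.AtPrime (Ideal.span {x, g}))
      (Localization.AtPrime (Ideal.span {algebraMap S S' x, algebraMap S S' g}))) :=
    Localization.isLocalHom_localRingHom _ _ _ h𝔭𝔭'
  -- `ψ` is formally smooth and essentially of finite type
  haveI : Algebra.FormallySmooth S (Localization.AtPrime (Ideal.span {algebraMap S S' x, algebraMap S S' g})) :=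
    Algebra.FormallySmooth.comp S S' _
  haveI : Algebra.EssFiniteType S (Localization.AtPrime (Ideal.span {algebraMap S S' x, algebraMap S S' g})) :=
    Algebra.EssFiniteType.comp S S' _
  haveI : Algebra.FormallySmooth (Localization.AtPrime (Ideal.span {x, g}))
      (Localization.AtPrime (Ideal.span {algebraMap S S' x, algebraMap S S' g})) :=
    Algebra.FormallySmooth.localization_base (Ideal.span {x, g}).primeCompl
  haveI : Algebra.EssFiniteType (Localization.AtPrime (Ideal.span {x, g}))
      (Localization.AtPrime (Ideal.span {algebraMap S S' x, algebraMap S S' g})) :=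
    Algebra.EssFiniteType.of_comp S _ _
  -- (c11)↾≤2 along `ψ`
  have hdimT := ringKrullDim_atPrime_span_pair_le_two (R := S') (algebraMap S S' x) (algebraMap S S' g)
  obtain ⟨-, hJ⟩ := EssSmoothCentre.iotaJEssSmoothCompatibleLE2_iotaOrd_jContact
    (Localization.AtPrime (Ideal.span {x, g}))
    (Localization.AtPrime (Ideal.span {algebraMap S S' x, algebraMap S S' g}))
    (algebraMap S (Localization.AtPrime (Ideal.span {x, g})) f) hdimT
  have hfT : algebraMap S (Localization.AtPrime (Ideal.span {algebraMap S S' x, algebraMap S S' g})) f =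
      algebraMap (Localization.AtPrime (Ideal.span {x, g})) _
        (algebraMap S (Localization.AtPrime (Ideal.span {x, g})) f) :=
    IsScalarTower.algebraMap_apply S (Localization.AtPrime (Ideal.span {x, g})) _ f
  -- the value at `S_𝔭`: CASE B in the coordinates `(x/1, g/1)`
  obtain ⟨hmax, hg2⟩ := span_pair_eq_maximalIdeal_atPrime_and_not_mem_sq S x g hxg hli
  have hvec𝔭 : (fun i => algebraMap S (Localization.AtPrime (Ideal.span {x, g})) ((![x, g] : Fin 2 → S) i)) =
      ![algebraMap S (Localization.AtPrime (Ideal.span {x, g})) x,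
        algebraMap S (Localization.AtPrime (Ideal.span {x, g})) g] := by
    funext i; fin_cases i <;> rfl
  have hJ𝔭 : jContact (Localization.AtPrime (Ideal.span {x, g}))
      (algebraMap S (Localization.AtPrime (Ideal.span {x, g})) f) m =
      (weightedMonomialIdeal ![x, g] ![1, bMax (algebraMap S (Localization.AtPrime (Ideal.span {x, g})) f)] m).map
        (algebraMap S (Localization.AtPrime (Ideal.span {x, g}))) := by
    rw [← weightedMonomialIdeal_eq_jContact _ hf0 hnm hmax hg2 hb hreach m, weightedMonomialIdeal_map, hvec𝔭]
  -- assemble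
  rw [hfT, hJ m, hJ𝔭, Ideal.map_map, ← IsScalarTower.algebraMap_eq S (Localization.AtPrime (Ideal.span {x, g})) _,
    IsScalarTower.algebraMap_eq S S' (Localization.AtPrime (Ideal.span {algebraMap S S' x, algebraMap S S' g})),
    ← Ideal.map_map, weightedMonomialIdeal_map (algebraMap S S'), hvec]
  have hu𝔭 : ∀ i, (![algebraMap S S' x, algebraMap S S' g] : Fin 2 → S') i ∈
      Ideal.span {algebraMap S S' x, algebraMap S S' g} := fun i =>
    Ideal.subset_span (by fin_cases i <;> simp)
  rcases Nat.eq_zero_or_pos m with rfl | hm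
  · rw [weightedMonomialIdeal_zero, Ideal.map_top, Ideal.comap_top]
  · exact comap_map_weightedMonomialIdeal_eq_of_linearIndependent _ _ hxg' hli' hu𝔭 _
      (Fin.forall_fin_two.2 ⟨Nat.one_pos, hb⟩) hm

end ContactCylinder

end Summit.ResolutionOfSingularities.ResolutionOfSingularities.Theorems

end
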